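import Summits.QuantumFields.BalabanUV.Beta.GAN24.DerivativeRateTransferLoewnerGramSchedule
import Summits.QuantumFields.BalabanUV.Beta.GAN24.DerivativeRateTransferJensenHolonomy

/-!
# `BalabanUV.Beta.GAN24.DerivativeRateTransferLoewnerGramScheduleEnd` — binder row G-an2-4 ∕ (CONV-C), route R6 «VALUES, NOT DERIVATIVES», PART 89:
# `towerEnd_of_plaquetteSchedule_of_mismatchSchedule` — PART 88's scheduled END fed LITERALLY by PART 56's `(s,t,r)`-family (the shape PARTs 64 ∕ 75 ∕ 85
# deliver on the block lattice for the three printed conventions): a HOLONOMY schedule `κ_j ≤ K₀·θ_p^j` (`κ_j = 2·2d(L−1)L·p̂_j` from the plaquette letter,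
# §3), the choice `t_j = K₀θ_p^j`, `r = 1` turning the polar coefficient into `1 + e_j`, `e_j ≤ (5 + 8ϖ + 4ϖ′)K₀·θ_p^j`; PLUS the lattice letters — plaquette
# schedule ⇒ holonomy schedule and BOTH windows of PART 84 at every level from ONE smallness `√(dim o)·2d(L−1)L·P₀ ≤ 1∕200`, the convention defect
# `1280D_F³ + 200704D_F⁴ ≤ 2284·D_F³` (third order, decays like `θ_p^{3j}`), and the composition of two bond-by-bond transfers (`τ = τ′ + τ″`: convention
# defect PLUS tower mismatch feed PART 56's `hτ` as ONE letter) (unit b2b-balaban-gan24-p3, gen 47; v1 — gan24-idea-1 g62 (G) ∕ g63 LENS 20, `θ_m` FREE)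

NOT IN PRINT; OUR PROOF (for the ROUTE; [folklore] arithmetic; PART 88 `towerEnd_of_stabFamily_of_schedules` ∕ `exists_effForm_limit_of_stabFamily_of_schedules`
and PART 25's square-root-free triangle inequality `dotProduct_self_add_le_sq` BY NAME).  HONEST FRAMING (cell contract, verbatim): «discharging `BetaPertH` makes Bałaban's UV stability
UNCONDITIONAL — a real constructive-QFT result; it is NOT the continuum limit and NOT the Clay problem.»  HONEST DEPENDENCY (verbatim): «continuum YM on T⁴ ⇐
BetaPertH ∧ nine spine estimates (0/9 proved); BetaPertH ⇐ (D1) ∧ (D4) ∧ CAP+tail; G-an2-4 gates asym, D1 and NE2/3/4.»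

WHAT THIS FILE PROVES (0 sorry, 0 `def`, nothing cited):
* §1 `polarCoeff_sub_one_nonneg`, **`polarCoeff_sub_one_le`**: PART 56's coefficient `c(t,r) = 1 + t + (1+t⁻¹)(1+r)ϖκ² + (1+t⁻¹)(1+r⁻¹)(3κ²∕(4−κ²))(1+ϖ+ϖ′)`
  at `r = 1`, `0 ≤ κ ≤ t ≤ 1`: `0 ≤ c(t,1) − 1 ≤ (5 + 8ϖ + 4ϖ′)·t`.
* §2 **`towerEnd_of_plaquetteSchedule_of_mismatchSchedule`** (gan24-idea-1 g62's (G), `θ_m` free): PART 20's structural hypotheses, (CONS) `≤ cst·θ^j`, `|𝒮_j| ≤ B`,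
  the family `∀ s t r > 0, 0 ≤ ((1+s)·c_j(t,r))•H_{j+1} + ((1+s⁻¹)τ_j²)•G_{j+1} − Qf_jᵀH_jQf_j`, schedules `0 ≤ κ_j ≤ K₀θ_p^j` (`0 < K₀ ≤ 1`),
  `0 ≤ τ_j ≤ M₀θ_m^j`, growth `|(ℋ_jᵀG_jℋ_j)_{ab}| ≤ N₀Λ^j`, `0 < θ_p ≤ θ ≤ 1`, `0 ≤ ϖ, ϖ′, N₀, Λ`, `hrate : θ_m²Λ ≤ θ²` ⟹
  `|𝒮_{j+1}(a,b) − 𝒮_j(a,b)| ≤ (cst + 2(1 + 2(5 + 8ϖ + 4ϖ′)K₀)·B + 4M₀²N₀Λ)·θ^j`; **`exists_effForm_limit_of_plaquetteSchedule_of_mismatchSchedule`** (+ `θ < 1`: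
  the entrywise limit `𝒮_∞` with tail `C·θ^j∕(1−θ)`).
* §3 the lattice letters: `holonomy_le_of_plaquetteSchedule` (`2·(2d(L−1)·(L·p̂_j)) ≤ (4d(L−1)L·P₀)·θ_p^j`), `windows_of_plaquetteSchedule` (PART 84's
  `2d(L−1)Lp̂_j < 1` and `√(dim o)·2d(L−1)Lp̂_j ≤ 1∕200` at EVERY level from `√(dim o)·2d(L−1)L·P₀ ≤ 1∕200`, `dim o ≥ 1`, `θ_p ≤ 1`),
  `conventionDefect_le` (`0 ≤ x ≤ 1∕200` ⟹ `1280x³ + 200704x⁴ ≤ 2284x³`), `schedule_add` (two schedules add at the slower rate),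
  `dotProduct_self_add_mulVec_le` (`|Aw|² ≤ a²|w|²`, `|Bw|² ≤ b²|w|²` ⟹ `|(A+B)w|² ≤ (a+b)²|w|²`: two transfers compose additively in PART 56's `τ`).
WHAT IT DOES NOT DO: instantiate Bałaban's tower (`H_j`, `Qf_j`, `Qc_j` from his `Δ_k`, `Q̄`); supply the tower's link-mismatch schedule `τ_j ≤ M₀θ_m^j` (LENS 20's
`θ_m = L^{−4∕3}` road is print + R9° + NE3's leaf, untyped) or the count `Λ` (`= L²` in the energy normalisation — PART 88's docstring); touch (CONS) ∕ S2.
SUPPLIER work on route R6 (rank 2, REDUCTION, no seat); no consumer of record; NEVER «G-an2-4 closed»; NOT (CONV-C), NOT D1, NOT `BetaPertH`, NOT continuum, NOT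
Clay.  Records: `HOME/b2b-balaban-gan24-p3/WOODBURY-FIBRE.md` v14.7, `HOME/beta/ROUTES-GAN24.md` v63 l.903 (G) ∕ l.905 (E).
-/

noncomputable section

open Set Matrix Filter Topology

namespace Summit.QuantumFields.BalabanUV.Beta.GAN24.DerivativeRateTransferLoewnerGramScheduleEnd

open Literature.MathematicalPhysics.QuantumFieldTheory.Balaban1983to89.Beta.Composition (kkt)
open Literature.MathematicalPhysics.QuantumFieldTheory.Balaban1983to89.Beta.CompositionSingular (effForm minOp)
open Summit.QuantumFields.BalabanUV.Beta.GAN24.DerivativeRateTransferLoewnerGramSchedule (towerEnd_of_stabFamily_of_schedules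
  exists_effForm_limit_of_stabFamily_of_schedules)
open Summit.QuantumFields.BalabanUV.Beta.GAN24.DerivativeRateTransferJensenChain (dotProduct_self_nonneg')
open Summit.QuantumFields.BalabanUV.Beta.GAN24.DerivativeRateTransferJensenHolonomy (dotProduct_self_add_le_sq)

/-! ## §1 PART 56's polar coefficient at `t = K₀θ_p^j`, `r = 1` -/

section Coeff

variable {ϖ ϖ' κ t : ℝ}

/-- the polar coefficient minus one is nonnegative (`0 < t`, `0 ≤ ϖ, ϖ′`, `κ² ≤ 1`). [folklore arithmetic] -/
theorem polarCoeff_sub_one_nonneg (hϖ : 0 ≤ ϖ) (hϖ' : 0 ≤ ϖ') (ht : 0 < t) (hκ0 : 0 ≤ κ) (hκ1 : κ ≤ 1) :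
    0 ≤ (1 + t + (1 + t⁻¹) * (1 + 1) * ϖ * κ ^ 2 + (1 + t⁻¹) * (1 + (1 : ℝ)⁻¹) * (3 * κ ^ 2 / (4 - κ ^ 2)) * (1 + ϖ + ϖ')) - 1 := by
  have hκ2 : κ ^ 2 ≤ 1 := by nlinarith
  have h4 : 0 < 4 - κ ^ 2 := by linarith
  have h3 : 0 ≤ 3 * κ ^ 2 / (4 - κ ^ 2) := div_nonneg (by positivity) h4.le
  have ht' : 0 ≤ 1 + t⁻¹ := by positivity
  rw [inv_one]
  nlinarith [mul_nonneg (mul_nonneg (mul_nonneg ht' (by norm_num : (0:ℝ) ≤ 1 + 1)) hϖ) (sq_nonneg κ),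
    mul_nonneg (mul_nonneg (mul_nonneg ht' (by norm_num : (0:ℝ) ≤ 1 + 1)) h3) (by linarith : (0:ℝ) ≤ 1 + ϖ + ϖ')]

/-- **`polarCoeff_sub_one_le` — THE POLAR SLACK IS FIRST ORDER IN THE HOLONOMY SCHEDULE** [folklore arithmetic]: `0 ≤ ϖ, ϖ′`, `0 ≤ κ ≤ t ≤ 1` (`0 < t`) ⟹
`c(t,1) − 1 ≤ (5 + 8ϖ + 4ϖ′)·t` (since `(1+t⁻¹)κ² ≤ (1+t⁻¹)t² ≤ 2t` and `3κ²∕(4−κ²) ≤ κ²`). -/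
theorem polarCoeff_sub_one_le (hϖ : 0 ≤ ϖ) (hϖ' : 0 ≤ ϖ') (ht : 0 < t) (ht1 : t ≤ 1) (hκ0 : 0 ≤ κ) (hκt : κ ≤ t) :
    (1 + t + (1 + t⁻¹) * (1 + 1) * ϖ * κ ^ 2 + (1 + t⁻¹) * (1 + (1 : ℝ)⁻¹) * (3 * κ ^ 2 / (4 - κ ^ 2)) * (1 + ϖ + ϖ')) - 1 ≤
      (5 + 8 * ϖ + 4 * ϖ') * t := by
  have hκ1 : κ ≤ 1 := hκt.trans ht1
  have hκ2 : κ ^ 2 ≤ 1 := by nlinarith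
  have h4 : 0 < 4 - κ ^ 2 := by linarith
  have ht' : 0 ≤ 1 + t⁻¹ := by positivity
  -- `(1+t⁻¹)κ² ≤ 2t`
  have hA : (1 + t⁻¹) * κ ^ 2 ≤ 2 * t := by
    have hκt2 : κ ^ 2 ≤ t ^ 2 := pow_le_pow_left₀ hκ0 hκt 2
    have h1 : (1 + t⁻¹) * κ ^ 2 ≤ (1 + t⁻¹) * t ^ 2 := mul_le_mul_of_nonneg_left hκt2 ht'
    have h2 : (1 + t⁻¹) * t ^ 2 = t ^ 2 + t := by field_simp
    nlinarith
  -- `3κ²∕(4−κ²) ≤ κ²`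
  have hB : 3 * κ ^ 2 / (4 - κ ^ 2) ≤ κ ^ 2 := by
    rw [div_le_iff₀ h4]; nlinarith [mul_le_mul_of_nonneg_left hκ2 (sq_nonneg κ)]
  have hB' : (1 + t⁻¹) * (3 * κ ^ 2 / (4 - κ ^ 2)) ≤ 2 * t := (mul_le_mul_of_nonneg_left hB ht').trans hA
  rw [inv_one]
  have e1 : (1 + t + (1 + t⁻¹) * (1 + 1) * ϖ * κ ^ 2 + (1 + t⁻¹) * (1 + 1) * (3 * κ ^ 2 / (4 - κ ^ 2)) * (1 + ϖ + ϖ')) - 1 =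
      t + 2 * ϖ * ((1 + t⁻¹) * κ ^ 2) + 2 * (1 + ϖ + ϖ') * ((1 + t⁻¹) * (3 * κ ^ 2 / (4 - κ ^ 2))) := by ring
  rw [e1]
  have h1 : 2 * ϖ * ((1 + t⁻¹) * κ ^ 2) ≤ 2 * ϖ * (2 * t) := mul_le_mul_of_nonneg_left hA (by positivity)
  have h2 : 2 * (1 + ϖ + ϖ') * ((1 + t⁻¹) * (3 * κ ^ 2 / (4 - κ ^ 2))) ≤ 2 * (1 + ϖ + ϖ') * (2 * t) :=
    mul_le_mul_of_nonneg_left hB' (by positivity)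
  nlinarith

end Coeff

/-! ## §2 `towerEnd_of_plaquetteSchedule_of_mismatchSchedule` -/

section Tower

variable {c : Type*} [Fintype c] [DecidableEq c]
variable {ι : ℕ → Type*} [∀ j, Fintype (ι j)] [∀ j, DecidableEq (ι j)]
variable {H : ∀ j, Matrix (ι j) (ι j) ℝ} {Qf : ∀ j, Matrix (ι j) (ι (j + 1)) ℝ} {Qc : ∀ j, Matrix c (ι j) ℝ}
variable {P : ∀ j, Matrix (ι (j + 1)) (ι j) ℝ} {G : ∀ j, Matrix (ι j) (ι j) ℝ} {κ τ : ℕ → ℝ} {cst B K₀ M₀ N₀ Λ θ θp θm ϖ ϖ' : ℝ}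

/-- **`towerEnd_of_plaquetteSchedule_of_mismatchSchedule` — PART 20's TOWER END FROM PART 56's FAMILY, A HOLONOMY (PLAQUETTE) SCHEDULE AND A MISMATCH
SCHEDULE** [our proof; gan24-idea-1 g62 (G) with `θ_m` FREE].  Tower of PSD fine forms, nonsingular bordered matrices, `Qc (j+1) = Qc j · Qf j`, `Qc (j+1) · P j = Qc j`,
symmetric mass forms; (CONS_{j,y}) `≤ cst·θ^j`; k-uniform `|𝒮_j(a,b)| ≤ B`; PART 56's family — for all `s, t, r > 0`,
`0 ≤ ((1+s)(1 + t + (1+t⁻¹)(1+r)ϖκ_j² + (1+t⁻¹)(1+r⁻¹)(3κ_j²∕(4−κ_j²))(1+ϖ+ϖ′)))•H_{j+1} + ((1+s⁻¹)τ_j²)•G_{j+1} − Qf_jᵀH_jQf_j` (`κ_j` the level-`j` holonomy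
letter, `= 2·2d(L−1)L·p̂_j` on the block lattice — §3; `G_{j+1}` absorbing `w_c·d′`); the HOLONOMY schedule `0 ≤ κ_j ≤ K₀·θ_p^j` with `0 < K₀ ≤ 1`; the MISMATCH
schedule `0 ≤ τ_j ≤ M₀·θ_m^j`; the GROWTH letter `|(ℋ_jᵀG_jℋ_j)_{ab}| ≤ N₀·Λ^j`; `0 < θ_p ≤ θ ≤ 1`, `0 ≤ ϖ, ϖ′, N₀, Λ`; **`hrate : θ_m²·Λ ≤ θ²`** ⟹
`∀ j a b, |𝒮_{j+1}(a,b) − 𝒮_j(a,b)| ≤ (cst + 2(1 + 2(5 + 8ϖ + 4ϖ′)K₀)·B + 4·M₀²N₀Λ)·θ^j` (choices `t_j = K₀θ_p^j`, `r = 1`, `s_j = θ^j`). -/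
theorem towerEnd_of_plaquetteSchedule_of_mismatchSchedule (hH : ∀ j, (H j).PosSemidef) (hk : ∀ j, IsUnit (kkt (H j) (Qc j)).det)
    (hcomp : ∀ j, Qc (j + 1) = Qc j * Qf j) (hPQ : ∀ j, Qc (j + 1) * P j = Qc j) (hG : ∀ j, (G j)ᵀ = G j)
    (hstab : ∀ j (s t r : ℝ), 0 < s → 0 < t → 0 < r →
      ((((1 + s) * (1 + t + (1 + t⁻¹) * (1 + r) * ϖ * κ j ^ 2 + (1 + t⁻¹) * (1 + r⁻¹) * (3 * κ j ^ 2 / (4 - κ j ^ 2)) * (1 + ϖ + ϖ'))) •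
          H (j + 1) + ((1 + s⁻¹) * τ j ^ 2) • G (j + 1) - (Qf j)ᵀ * H j * Qf j).PosSemidef))
    (hcons : ∀ j (y : c), (minOp (H j) (Qc j) *ᵥ Pi.single y 1) ⬝ᵥ
        (((P j)ᵀ * H (j + 1) * P j - H j) *ᵥ (minOp (H j) (Qc j) *ᵥ Pi.single y 1)) ≤ cst * θ ^ j)
    (hB : ∀ j a b, |effForm (H j) (Qc j) a b| ≤ B)
    (hκ : ∀ j, 0 ≤ κ j ∧ κ j ≤ K₀ * θp ^ j) (hK₀ : 0 < K₀) (hK₀1 : K₀ ≤ 1) (hτ : ∀ j, 0 ≤ τ j ∧ τ j ≤ M₀ * θm ^ j)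
    (hN : ∀ j a b, |((minOp (H j) (Qc j))ᵀ * G j * minOp (H j) (Qc j)) a b| ≤ N₀ * Λ ^ j)
    (hϖ : 0 ≤ ϖ) (hϖ' : 0 ≤ ϖ') (hθ : 0 < θ) (hθ1 : θ ≤ 1) (hθp : 0 < θp) (hθpθ : θp ≤ θ) (hN₀ : 0 ≤ N₀) (hΛ : 0 ≤ Λ)
    (hrate : θm ^ 2 * Λ ≤ θ ^ 2) :
    ∀ j (a b : c), |effForm (H (j + 1)) (Qc (j + 1)) a b - effForm (H j) (Qc j) a b| ≤
      (cst + 2 * (1 + 2 * ((5 + 8 * ϖ + 4 * ϖ') * K₀)) * B + 4 * (M₀ ^ 2 * N₀ * Λ)) * θ ^ j := by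
  -- the choice `t_j = K₀θ_p^j`, `r = 1`: `e_j := c_j(t_j, 1) − 1`
  have ht : ∀ j, 0 < K₀ * θp ^ j := fun j => mul_pos hK₀ (pow_pos hθp j)
  have ht1 : ∀ j, K₀ * θp ^ j ≤ 1 := fun j =>
    (mul_le_mul_of_nonneg_left (pow_le_one₀ hθp.le (hθpθ.trans hθ1)) hK₀.le).trans (by rw [mul_one]; exact hK₀1)
  refine towerEnd_of_stabFamily_of_schedules (E₀ := (5 + 8 * ϖ + 4 * ϖ') * K₀) (θp := θp)
    (e := fun j => (1 + K₀ * θp ^ j + (1 + (K₀ * θp ^ j)⁻¹) * (1 + 1) * ϖ * κ j ^ 2 +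
      (1 + (K₀ * θp ^ j)⁻¹) * (1 + (1 : ℝ)⁻¹) * (3 * κ j ^ 2 / (4 - κ j ^ 2)) * (1 + ϖ + ϖ')) - 1)
    hH hk hcomp hPQ hG (fun j s hs => ?_) hcons hB (fun j => ⟨?_, ?_⟩) hτ hN hθ hθ1 hθp.le hθpθ (by positivity) hN₀ hΛ hrate
  · have h := hstab j s (K₀ * θp ^ j) 1 hs (ht j) one_pos
    have e1 : (1 + (1 + K₀ * θp ^ j + (1 + (K₀ * θp ^ j)⁻¹) * (1 + 1) * ϖ * κ j ^ 2 +
        (1 + (K₀ * θp ^ j)⁻¹) * (1 + (1 : ℝ)⁻¹) * (3 * κ j ^ 2 / (4 - κ j ^ 2)) * (1 + ϖ + ϖ') - 1)) =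
        1 + K₀ * θp ^ j + (1 + (K₀ * θp ^ j)⁻¹) * (1 + 1) * ϖ * κ j ^ 2 +
          (1 + (K₀ * θp ^ j)⁻¹) * (1 + (1 : ℝ)⁻¹) * (3 * κ j ^ 2 / (4 - κ j ^ 2)) * (1 + ϖ + ϖ') := by ring
    rw [e1]; exact h
  · exact polarCoeff_sub_one_nonneg hϖ hϖ' (ht j) (hκ j).1 ((hκ j).2.trans (ht1 j))
  · have := polarCoeff_sub_one_le hϖ hϖ' (ht j) (ht1 j) (hκ j).1 (hκ j).2
    exact this.trans_eq (mul_assoc _ _ _).symm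

/-- **`exists_effForm_limit_of_plaquetteSchedule_of_mismatchSchedule` — THE LIMIT FORM WITH THE (CONV-C)-SHAPED TAIL** [our proof]: under the same
hypotheses and `θ < 1`: `∃ 𝒮_∞`, `𝒮_j(a,b) → 𝒮_∞(a,b)` and `|𝒮_j(a,b) − 𝒮_∞(a,b)| ≤ (cst + 2(1 + 2(5 + 8ϖ + 4ϖ′)K₀)B + 4M₀²N₀Λ)·θ^j∕(1 − θ)`. -/
theorem exists_effForm_limit_of_plaquetteSchedule_of_mismatchSchedule (hH : ∀ j, (H j).PosSemidef)
    (hk : ∀ j, IsUnit (kkt (H j) (Qc j)).det)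
    (hcomp : ∀ j, Qc (j + 1) = Qc j * Qf j) (hPQ : ∀ j, Qc (j + 1) * P j = Qc j) (hG : ∀ j, (G j)ᵀ = G j)
    (hstab : ∀ j (s t r : ℝ), 0 < s → 0 < t → 0 < r →
      ((((1 + s) * (1 + t + (1 + t⁻¹) * (1 + r) * ϖ * κ j ^ 2 + (1 + t⁻¹) * (1 + r⁻¹) * (3 * κ j ^ 2 / (4 - κ j ^ 2)) * (1 + ϖ + ϖ'))) •
          H (j + 1) + ((1 + s⁻¹) * τ j ^ 2) • G (j + 1) - (Qf j)ᵀ * H j * Qf j).PosSemidef))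
    (hcons : ∀ j (y : c), (minOp (H j) (Qc j) *ᵥ Pi.single y 1) ⬝ᵥ
        (((P j)ᵀ * H (j + 1) * P j - H j) *ᵥ (minOp (H j) (Qc j) *ᵥ Pi.single y 1)) ≤ cst * θ ^ j)
    (hB : ∀ j a b, |effForm (H j) (Qc j) a b| ≤ B)
    (hκ : ∀ j, 0 ≤ κ j ∧ κ j ≤ K₀ * θp ^ j) (hK₀ : 0 < K₀) (hK₀1 : K₀ ≤ 1) (hτ : ∀ j, 0 ≤ τ j ∧ τ j ≤ M₀ * θm ^ j)
    (hN : ∀ j a b, |((minOp (H j) (Qc j))ᵀ * G j * minOp (H j) (Qc j)) a b| ≤ N₀ * Λ ^ j)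
    (hϖ : 0 ≤ ϖ) (hϖ' : 0 ≤ ϖ') (hθ : 0 < θ) (hθ1 : θ < 1) (hθp : 0 < θp) (hθpθ : θp ≤ θ) (hN₀ : 0 ≤ N₀) (hΛ : 0 ≤ Λ)
    (hrate : θm ^ 2 * Λ ≤ θ ^ 2) :
    ∃ Sinf : Matrix c c ℝ, ∀ a b : c, Tendsto (fun j => effForm (H j) (Qc j) a b) atTop (𝓝 (Sinf a b)) ∧
      ∀ j, |effForm (H j) (Qc j) a b - Sinf a b| ≤
        (cst + 2 * (1 + 2 * ((5 + 8 * ϖ + 4 * ϖ') * K₀)) * B + 4 * (M₀ ^ 2 * N₀ * Λ)) * θ ^ j / (1 - θ) := by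
  have ht : ∀ j, 0 < K₀ * θp ^ j := fun j => mul_pos hK₀ (pow_pos hθp j)
  have ht1 : ∀ j, K₀ * θp ^ j ≤ 1 := fun j =>
    (mul_le_mul_of_nonneg_left (pow_le_one₀ hθp.le (hθpθ.trans hθ1.le)) hK₀.le).trans (by rw [mul_one]; exact hK₀1)
  refine exists_effForm_limit_of_stabFamily_of_schedules (E₀ := (5 + 8 * ϖ + 4 * ϖ') * K₀) (θp := θp)
    (e := fun j => (1 + K₀ * θp ^ j + (1 + (K₀ * θp ^ j)⁻¹) * (1 + 1) * ϖ * κ j ^ 2 +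
      (1 + (K₀ * θp ^ j)⁻¹) * (1 + (1 : ℝ)⁻¹) * (3 * κ j ^ 2 / (4 - κ j ^ 2)) * (1 + ϖ + ϖ')) - 1)
    hH hk hcomp hPQ hG (fun j s hs => ?_) hcons hB (fun j => ⟨?_, ?_⟩) hτ hN hθ hθ1 hθp.le hθpθ (by positivity) hN₀ hΛ hrate
  · have h := hstab j s (K₀ * θp ^ j) 1 hs (ht j) one_pos
    have e1 : (1 + (1 + K₀ * θp ^ j + (1 + (K₀ * θp ^ j)⁻¹) * (1 + 1) * ϖ * κ j ^ 2 +
        (1 + (K₀ * θp ^ j)⁻¹) * (1 + (1 : ℝ)⁻¹) * (3 * κ j ^ 2 / (4 - κ j ^ 2)) * (1 + ϖ + ϖ') - 1)) =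
        1 + K₀ * θp ^ j + (1 + (K₀ * θp ^ j)⁻¹) * (1 + 1) * ϖ * κ j ^ 2 +
          (1 + (K₀ * θp ^ j)⁻¹) * (1 + (1 : ℝ)⁻¹) * (3 * κ j ^ 2 / (4 - κ j ^ 2)) * (1 + ϖ + ϖ') := by ring
    rw [e1]; exact h
  · exact polarCoeff_sub_one_nonneg hϖ hϖ' (ht j) (hκ j).1 ((hκ j).2.trans (ht1 j))
  · have := polarCoeff_sub_one_le hϖ hϖ' (ht j) (ht1 j) (hκ j).1 (hκ j).2
    exact this.trans_eq (mul_assoc _ _ _).symm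

end Tower

/-! ## §3 The lattice letters: plaquette schedule ⇒ holonomy schedule, windows, convention defect, composition of transfers -/

section Lattice

/-- **`holonomy_le_of_plaquetteSchedule`** — PART 84's holonomy letter `2D`, `D = 2d(L−1)·(L·p̂)`, under the plaquette schedule `p̂_j ≤ P₀θ_p^j`:
`2·(2(d(L−1))(Lp̂_j)) ≤ (4d(L−1)L·P₀)·θ_p^j` (`1 ≤ L`). [folklore arithmetic] -/
theorem holonomy_le_of_plaquetteSchedule {d L : ℕ} (hL : 1 ≤ L) {phat : ℕ → ℝ} {P₀ θp : ℝ} {j : ℕ} (hp : phat j ≤ P₀ * θp ^ j) :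
    2 * (2 * (d * ((L : ℝ) - 1)) * (L * phat j)) ≤ (4 * (d * ((L : ℝ) - 1)) * L * P₀) * θp ^ j := by
  have hL1 : (1 : ℝ) ≤ L := by exact_mod_cast hL
  have hc : 0 ≤ 4 * (d * ((L : ℝ) - 1)) * L := by
    have : 0 ≤ (L : ℝ) - 1 := by linarith
    positivity
  have := mul_le_mul_of_nonneg_left hp hc
  nlinarith

/-- **`windows_of_plaquetteSchedule`** — BOTH WINDOWS OF PART 84 AT EVERY LEVEL FROM ONE SMALLNESS: `dim o ≥ 1`, `0 ≤ p̂_j ≤ P₀θ_p^j`, `0 ≤ P₀`,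
`0 ≤ θ_p ≤ 1`, `1 ≤ L`, `√(dim o)·(2d(L−1)L·P₀) ≤ 1∕200` ⟹ `2d(L−1)(Lp̂_j) < 1` and `√(dim o)·(2d(L−1)(Lp̂_j)) ≤ 1∕200`. [folklore arithmetic] -/
theorem windows_of_plaquetteSchedule {d L n : ℕ} (hL : 1 ≤ L) (hn : 1 ≤ n) {phat : ℕ → ℝ} {P₀ θp : ℝ} (hP₀ : 0 ≤ P₀) (hθp : 0 ≤ θp)
    (hθp1 : θp ≤ 1) {j : ℕ} (hp0 : 0 ≤ phat j) (hp : phat j ≤ P₀ * θp ^ j)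
    (hwin : Real.sqrt n * (2 * (d * ((L : ℝ) - 1)) * (L * P₀)) ≤ 1 / 200) :
    2 * (d * ((L : ℝ) - 1)) * (L * phat j) < 1 ∧ Real.sqrt n * (2 * (d * ((L : ℝ) - 1)) * (L * phat j)) ≤ 1 / 200 := by
  have hL1 : (1 : ℝ) ≤ L := by exact_mod_cast hL
  have hLm : 0 ≤ (L : ℝ) - 1 := by linarith
  have hc : 0 ≤ 2 * (d * ((L : ℝ) - 1)) * L := by positivity
  have hsq : 1 ≤ Real.sqrt n := by
    rw [← Real.sqrt_one]; exact Real.sqrt_le_sqrt (by exact_mod_cast hn)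
  have hP : phat j ≤ P₀ := by
    calc phat j ≤ P₀ * θp ^ j := hp
      _ ≤ P₀ * 1 := mul_le_mul_of_nonneg_left (pow_le_one₀ hθp hθp1) hP₀
      _ = P₀ := mul_one _
  have hD : 2 * (d * ((L : ℝ) - 1)) * (L * phat j) ≤ 2 * (d * ((L : ℝ) - 1)) * (L * P₀) := by
    have := mul_le_mul_of_nonneg_left hP hc; nlinarith
  have hD0 : 0 ≤ 2 * (d * ((L : ℝ) - 1)) * (L * phat j) := by positivity
  have h2 : Real.sqrt n * (2 * (d * ((L : ℝ) - 1)) * (L * phat j)) ≤ 1 / 200 :=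
    (mul_le_mul_of_nonneg_left hD (by positivity)).trans hwin
  refine ⟨?_, h2⟩
  have h3 : 2 * (d * ((L : ℝ) - 1)) * (L * phat j) ≤ Real.sqrt n * (2 * (d * ((L : ℝ) - 1)) * (L * phat j)) := by
    have := mul_le_mul_of_nonneg_right hsq hD0; rwa [one_mul] at this
  linarith

/-- **`conventionDefect_le`** — PART 77 ∕ 84's polar-vs-Karcher defect is THIRD ORDER inside the window: `0 ≤ x ≤ 1∕200` ⟹ `1280x³ + 200704x⁴ ≤ 2284x³`
(so under `D_{F,j} ≤ X₀θ_p^j` it decays like `θ_p^{3j}`). [folklore arithmetic] -/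
theorem conventionDefect_le {x : ℝ} (hx0 : 0 ≤ x) (hx : x ≤ 1 / 200) : 1280 * x ^ 3 + 200704 * x ^ 4 ≤ 2284 * x ^ 3 := by
  have h3 : 0 ≤ x ^ 3 := pow_nonneg hx0 3
  have h4 : x ^ 4 ≤ x ^ 3 * (1 / 200) := by rw [pow_succ]; exact mul_le_mul_of_nonneg_left hx h3
  nlinarith

/-- **`schedule_add`** — two schedules add at the slower rate: `a ≤ A·ρ₁^j`, `b ≤ B·ρ₂^j`, `0 ≤ ρ₁ ≤ ρ₂`, `0 ≤ A` ⟹ `a + b ≤ (A + B)·ρ₂^j` (the convention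
defect `θ_p³`-schedule plus the tower's mismatch `θ_m`-schedule give ONE `τ`-schedule when `θ_p³ ≤ θ_m`). [folklore arithmetic] -/
theorem schedule_add {a b A B ρ₁ ρ₂ : ℝ} {j : ℕ} (ha : a ≤ A * ρ₁ ^ j) (hb : b ≤ B * ρ₂ ^ j) (hρ₁ : 0 ≤ ρ₁) (hρ : ρ₁ ≤ ρ₂) (hA : 0 ≤ A) :
    a + b ≤ (A + B) * ρ₂ ^ j := by
  have h := mul_le_mul_of_nonneg_left (pow_le_pow_left₀ hρ₁ hρ j) hA
  linarith

variable {o : Type*} [Fintype o]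

/-- **`dotProduct_self_add_mulVec_le` — TWO BOND-BY-BOND TRANSFERS COMPOSE ADDITIVELY IN PART 56's `τ`** [folklore; Cauchy–Schwarz]: `|Aw|² ≤ a²|w|²`,
`|Bw|² ≤ b²|w|²`, `0 ≤ a, b` ⟹ `|(A + B)w|² ≤ (a + b)²|w|²` (so `R‴ − R′ = (R‴ − R″) + (R″ − R′)`: the convention defect and the tower's link mismatch feed
PART 56's `hτ` as the single letter `τ = τ′ + τ″`). -/
theorem dotProduct_self_add_mulVec_le {A B : Matrix o o ℝ} {a b : ℝ} (ha : 0 ≤ a) (hb : 0 ≤ b)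
    (hA : ∀ w : o → ℝ, (A *ᵥ w) ⬝ᵥ (A *ᵥ w) ≤ a ^ 2 * (w ⬝ᵥ w)) (hB : ∀ w : o → ℝ, (B *ᵥ w) ⬝ᵥ (B *ᵥ w) ≤ b ^ 2 * (w ⬝ᵥ w))
    (w : o → ℝ) : ((A + B) *ᵥ w) ⬝ᵥ ((A + B) *ᵥ w) ≤ (a + b) ^ 2 * (w ⬝ᵥ w) := by
  rw [add_mulVec]
  exact dotProduct_self_add_le_sq _ _ ha hb (dotProduct_self_nonneg' w) (hA w) (hB w)

end Lattice

end Summit.QuantumFields.BalabanUV.Beta.GAN24.DerivativeRateTransferLoewnerGramScheduleEnd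

end
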